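import Mathlib.AlgebraicGeometry.Gluing
import Mathlib.AlgebraicGeometry.Morphisms.Immersion
import Mathlib.AlgebraicGeometry.Morphisms.Separated
import HarnessLib

/-!
# Gluing a scheme from one chart and transition morphisms

Weil's construction of the Jacobian (Milne, *Jacobian Varieties*, §7, proof of Thm. 7.1; Weil,
*Variétés abéliennes et courbes algébriques*, 1948) builds an algebraic group by gluing COPIES
of one variety `W` (an open of the symmetric power `C^{(g)}`) along birational "translation"
maps. This file packages that pattern as a `TransitionAtlas W`: opens `V i j ⊆ W` and transition
morphisms `t i j : V i j → W` with `V i i = W`, `t i i = id`, `t i j (V i j) ⊆ V j i`, the domain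
condition `x ∈ V i j, t i j x ∈ V j k ⟹ x ∈ V i k`, and the cocycle `t j k ∘ t i j = t i k` as
morphisms (`TransitionAtlas.cocycle`, stated against test morphisms so that no proof terms enter
the statement). From it:

* `TransitionAtlas.diagram` — the diagram `(i, U) ↦ U` on the preorder of pairs (chart index, open
  of `W`), `(i, U) ≤ (j, U')` iff `U ⊆ V i j` and `t i j (U) ⊆ U'`, with the (open immersion)
  transitions `x ↦ t i j x`; it is locally directed (`isLocallyDirected_diagram`), so Mathlib's
  colimit API for locally directed diagrams of open immersions (`AlgebraicGeometry/Gluing`) applies;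
* `TransitionAtlas.glued := colimit diagram`, the open-immersion charts `chart i : W ↪ glued`,
  the gluing relation `ι_chart : (V i j).ι ≫ chart i = t i j ≫ chart j`, and the EXACT point
  identification `chart_eq_chart_iff : chart i x = chart j y ↔ x ∈ V i j ∧ t i j x = y`;
  `exists_chart_apply_eq` (the charts cover), `openCover`, `desc`/`chart_desc`/`hom_ext`
  (morphisms out of the glued scheme), `toBase` (structure map when the transitions are
  `S`-morphisms), `isReduced_glued`, `locallyOfFiniteType_toBase`;
* `TransitionAtlas.isSeparated_toBase` — **separatedness criterion**: if the graphs
  `{(x, t i j x)} ⊆ W ×_S W` of the transitions are closed in `W ×_S W`, the glued scheme is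
  separated over `S` (the diagonal is, over the piece `W ×_S W` of the product cover indexed by
  `(i, j)`, the preimmersion with range that graph; `IsClosedImmersion.of_isPreimmersion`,
  `IsZariskiLocalAtTarget.iff_of_openCover`).

Compared with Mathlib's `Scheme.GlueData` (arbitrary charts `U i`, gluing data over the pullbacks
`V i j ×_{U i} V i k`), all charts here are the same scheme and the cocycle is an equality of
morphisms `U → W` on opens `U ⊆ W`, which is what a point-set recipe ("`E ↦` the effective divisor
linearly equivalent to `E - η_i + η_j`") verifies directly. Everything is proved; the `def`s are
constructions with bodies (D-0026), no named facts.

Mathlib searched (pin): `Scheme.IsLocallyDirected.ι_eq_ι_iff`, `ι_jointly_surjective`,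
`instance : HasColimit F` for locally directed diagrams of open immersions, `Scheme.GlueData`,
`Scheme.Cover.mkOfCovers`, `Scheme.Pullback.openCoverOfLeftRight`, `IsOpenImmersion.lift`,
`IsClosedImmersion.of_isPreimmersion`, `IsZariskiLocalAtTarget.iff_of_openCover` (all used).

## References

* J. S. Milne, *Jacobian Varieties*, in Cornell–Silverman (eds.), *Arithmetic Geometry* (1986), §7
  (proof of Thm. 7.1: `J` is obtained by gluing copies of an open of `C^{(g)}`). [Milne1986JacobianVarieties]
* A. Weil, *Variétés abéliennes et courbes algébriques*, Hermann (1948), nᵒ 31–34. [Weil1948]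
* R. Hartshorne, *Algebraic Geometry* (1977), II Ex. 2.12 (gluing schemes). [Hartshorne1977]
-/

noncomputable section

universe u

open CategoryTheory CategoryTheory.Limits AlgebraicGeometry TopologicalSpace

namespace Literature.AlgebraicGeometry.RelativeSpec

/-- **A transition atlas on a scheme `W`**: a family, indexed by `i j : ι`, of opens
`V i j ⊆ W` ("the part of chart `i` meeting chart `j`") and transition morphisms
`t i j : V i j → W` such that `V i i = W`, `t i i = id`, `t i j (V i j) ⊆ V j i`, the domain
condition `x ∈ V i j, t i j x ∈ V j k ⟹ x ∈ V i k`, and the cocycle `t j k ∘ t i j = t i k` (as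
MORPHISMS, on every open where both sides are defined; with `k = i` it says `t j i ∘ t i j = id`).
The glued scheme has one copy of `W` for each index, `x` in copy `i` being identified with
`t i j x` in copy `j` (Weil's "abstract varieties" given by birational transition data, as in
his construction of the Jacobian; Milne, *Jacobian Varieties*, §7; Mathlib's `Scheme.GlueData`
is the general form with arbitrary charts). [cite: Milne1986JacobianVarieties, §7 (proof of Thm. 7.1)] -/
structure TransitionAtlas (W : Scheme.{u}) where
  /-- The index type of the charts. -/
  ι : Type u
  /-- `V i j ⊆ W`: the domain of the transition from chart `i` to chart `j`. -/
  V : ι → ι → W.Opens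
  /-- The transition morphism `t i j : V i j → W`. -/
  t : ∀ i j : ι, (V i j : Scheme.{u}) ⟶ W
  V_self : ∀ i, V i i = ⊤
  t_self : ∀ i, t i i = (V i i).ι
  t_mem : ∀ i j (x : V i j), t i j x ∈ V j i
  dom : ∀ i j k (x : V i j), t i j x ∈ V j k → x.1 ∈ V i k
  cocycle : ∀ i j k (U : W.Opens) (a : (U : Scheme.{u}) ⟶ V i j) (b : (U : Scheme.{u}) ⟶ V j k)
    (c : (U : Scheme.{u}) ⟶ V i k), a ≫ (V i j).ι = U.ι → b ≫ (V j k).ι = a ≫ t i j →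
    c ≫ (V i k).ι = U.ι → b ≫ t j k = c ≫ t i k

namespace TransitionAtlas

variable {W : Scheme.{u}} (A : TransitionAtlas W)

/-- `t i i x = x`. [folklore] -/
theorem t_self_apply (i : A.ι) (x : A.V i i) : A.t i i x = x.1 := by
  rw [A.t_self]; rfl

/-- Morphism form of `t i i = id`: `a ≫ t i i = U.ι` for `a : U → V i i` over `W`. [folklore] -/
theorem comp_t_self (i : A.ι) {Z : Scheme.{u}} (a : Z ⟶ A.V i i) : a ≫ A.t i i = a ≫ (A.V i i).ι := by
  rw [A.t_self]

/-- `V i i = ⊤`, as an inequality. [folklore] -/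
theorem le_V_self (i : A.ι) (U : W.Opens) : U ≤ A.V i i := by
  rw [A.V_self]; exact le_top

/-- Pointwise cocycle: `t j k (t i j x) = t i k x`. [folklore] -/
theorem t_t_apply (i j k : A.ι) (x : W) (h₁ : x ∈ A.V i j) (h₂ : A.t i j ⟨x, h₁⟩ ∈ A.V j k) :
    A.t j k ⟨A.t i j ⟨x, h₁⟩, h₂⟩ = A.t i k ⟨x, A.dom i j k ⟨x, h₁⟩ h₂⟩ := by
  -- apply the cocycle on the open `U := V i j ⊓ (V i j).ι ''ᵁ (t i j ⁻¹ᵁ V j k)`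
  let U : W.Opens := A.V i j ⊓ (A.V i j).ι ''ᵁ (A.t i j ⁻¹ᵁ A.V j k)
  have hU₁ : U ≤ A.V i j := inf_le_left
  have hU₂ : ∀ y (hy : y ∈ U), A.t i j ⟨y, hU₁ hy⟩ ∈ A.V j k := by
    rintro _ ⟨hy₁, ⟨y', hy', rfl⟩⟩
    have e : (⟨(A.V i j).ι y', hU₁ ⟨hy₁, ⟨y', hy', rfl⟩⟩⟩ : ↥(A.V i j)) = y' :=
      Subtype.ext (by simp)
    have hy'' : A.t i j y' ∈ A.V j k := hy'
    rwa [← e] at hy''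
  have hU₃ : U ≤ A.V i k := fun y hy ↦ A.dom i j k ⟨y, hU₁ hy⟩ (hU₂ y hy)
  let a : (U : Scheme.{u}) ⟶ A.V i j := W.homOfLE hU₁
  have ha : ∀ y : U, a y = ⟨y.1, hU₁ y.2⟩ := fun y ↦ Scheme.homOfLE_apply' hU₁ y.1 y.2
  let b : (U : Scheme.{u}) ⟶ A.V j k := IsOpenImmersion.lift (A.V j k).ι (a ≫ A.t i j) (by
    rintro _ ⟨y, rfl⟩
    exact ⟨⟨A.t i j ⟨y.1, hU₁ y.2⟩, hU₂ y.1 y.2⟩, by rw [Scheme.Hom.comp_apply, ha]; rfl⟩)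
  let c : (U : Scheme.{u}) ⟶ A.V i k := W.homOfLE hU₃
  have hc := A.cocycle i j k U a b c (W.homOfLE_ι hU₁) (IsOpenImmersion.lift_fac _ _ _)
    (W.homOfLE_ι hU₃)
  have hx : x ∈ U := ⟨h₁, ⟨x, h₁⟩, h₂, rfl⟩
  have e := congrArg (fun φ ↦ φ ⟨x, hx⟩) hc
  simp only [Scheme.Hom.comp_apply] at e
  have e1 : b ⟨x, hx⟩ = ⟨A.t i j ⟨x, h₁⟩, h₂⟩ := by
    apply (A.V j k).ι.isOpenEmbedding.injective
    rw [← Scheme.Hom.comp_apply, IsOpenImmersion.lift_fac, Scheme.Hom.comp_apply, ha]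
    rfl
  have e2 : c ⟨x, hx⟩ = ⟨x, A.dom i j k ⟨x, h₁⟩ h₂⟩ := Scheme.homOfLE_apply' hU₃ x hx
  rw [e1, e2] at e
  exact e

/-- `t j i (t i j x) = x`. [folklore] -/
theorem t_t_self_apply (i j : A.ι) (x : A.V i j) :
    A.t j i ⟨A.t i j x, A.t_mem i j x⟩ = x.1 := by
  have := A.t_t_apply i j i x.1 x.2 (A.t_mem i j x)
  rw [this, A.t_self_apply]

/-- `x ∈ V i j ⟹ t i j x ∈ V j k ⟺ x ∈ V i k`. [folklore] -/
theorem t_mem_iff (i j k : A.ι) (x : A.V i j) : A.t i j x ∈ A.V j k ↔ x.1 ∈ A.V i k := by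
  refine ⟨A.dom i j k x, fun h ↦ ?_⟩
  have h' := A.dom j i k ⟨A.t i j x, A.t_mem i j x⟩
  rw [A.t_t_self_apply] at h'
  exact h' h

/-- `t i j` is an open immersion (its corestriction to `V j i` has the two-sided inverse given
by `t j i`). [folklore] -/
theorem isOpenImmersion_t (i j : A.ι) : IsOpenImmersion (A.t i j) := by
  -- corestrictions `s i j : V i j → V j i`
  let s : ∀ i j, (A.V i j : Scheme.{u}) ⟶ A.V j i := fun i j ↦
    IsOpenImmersion.lift (A.V j i).ι (A.t i j) (by rintro _ ⟨x, rfl⟩; exact ⟨⟨_, A.t_mem i j x⟩, rfl⟩)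
  have hs : ∀ i j, s i j ≫ (A.V j i).ι = A.t i j := fun i j ↦ IsOpenImmersion.lift_fac _ _ _
  have hss : ∀ i j, s i j ≫ s j i = 𝟙 _ := by
    intro i j
    rw [← cancel_mono (A.V i j).ι, Category.assoc, hs, Category.id_comp]
    have hc := A.cocycle i j i (A.V i j) (𝟙 _) (s i j) (W.homOfLE (A.le_V_self i _))
      (Category.id_comp _) (by rw [hs, Category.id_comp]) (W.homOfLE_ι _)
    rw [hc, comp_t_self, Scheme.homOfLE_ι]
  haveI : IsIso (s i j) := ⟨s j i, hss i j, hss j i⟩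
  rw [← hs i j]
  infer_instance

/-! ### The gluing diagram -/

/-- **The index preorder of the gluing diagram**: pairs `(i, U)` of a chart index and an open
`U ⊆ W`. [folklore] -/
structure Idx (A : TransitionAtlas W) : Type u where
  /-- The chart. -/
  i : A.ι
  /-- The open of the chart `W`. -/
  U : W.Opens

/-- `(i, U) ≤ (j, U')` iff `U ⊆ V i j` and `t i j (U) ⊆ U'`. [folklore] -/
instance : Preorder A.Idx where
  le a b := a.U ≤ A.V a.i b.i ∧ ∀ x (hx : x ∈ a.U) (hV : x ∈ A.V a.i b.i), A.t a.i b.i ⟨x, hV⟩ ∈ b.U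
  le_refl a := ⟨A.le_V_self a.i a.U, fun x hx hV ↦ by rw [A.t_self_apply]; exact hx⟩
  le_trans a b c hab hbc := by
    refine ⟨fun x hx ↦ A.dom a.i b.i c.i ⟨x, hab.1 hx⟩ (hbc.1 (hab.2 x hx _)), fun x hx hV ↦ ?_⟩
    have h := A.t_t_apply a.i b.i c.i x (hab.1 hx) (hbc.1 (hab.2 x hx _))
    rw [← h]
    exact hbc.2 _ (hab.2 x hx _) _

/-- Unfolding `≤` on the index preorder. [folklore] -/
theorem Idx.le_def (a b : A.Idx) : a ≤ b ↔
    a.U ≤ A.V a.i b.i ∧ ∀ x (hx : x ∈ a.U) (hV : x ∈ A.V a.i b.i), A.t a.i b.i ⟨x, hV⟩ ∈ b.U :=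
  Iff.rfl

/-- The transition of the diagram along `(i, U) ≤ (j, U')`: `U → U'`, `x ↦ t i j x`. [folklore] -/
def transition {a b : A.Idx} (h : a ≤ b) : (a.U : Scheme.{u}) ⟶ b.U :=
  IsOpenImmersion.lift b.U.ι (W.homOfLE h.1 ≫ A.t a.i b.i) (by
    rintro _ ⟨x, rfl⟩
    refine ⟨⟨A.t a.i b.i ⟨x.1, h.1 x.2⟩, h.2 x.1 x.2 _⟩, ?_⟩
    have e2 : W.homOfLE h.1 x = ⟨x.1, h.1 x.2⟩ := Subtype.ext (Scheme.homOfLE_apply _ x)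
    rw [Scheme.Hom.comp_apply, e2]
    rfl)

/-- `transition h ≫ U'.ι = (U ⊆ V i j) ≫ t i j`. [folklore] -/
@[reassoc (attr := simp)]
theorem transition_ι {a b : A.Idx} (h : a ≤ b) :
    A.transition h ≫ b.U.ι = W.homOfLE h.1 ≫ A.t a.i b.i :=
  IsOpenImmersion.lift_fac _ _ _

/-- Pointwise: `transition h x = t i j x`. [folklore] -/
theorem transition_apply {a b : A.Idx} (h : a ≤ b) (x : a.U) :
    (A.transition h x).1 = A.t a.i b.i ⟨x.1, h.1 x.2⟩ := by
  have e := congrArg (fun φ ↦ φ x) (A.transition_ι h)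
  simp only [Scheme.Hom.comp_apply] at e
  have e2 : W.homOfLE h.1 x = ⟨x.1, h.1 x.2⟩ := Subtype.ext (Scheme.homOfLE_apply _ x)
  rw [e2] at e
  exact e

/-- **The gluing diagram** `(i, U) ↦ U` with the transitions `x ↦ t i j x` (reducible, so that
`diagram.obj (i, U)` is syntactically the open subscheme `U`). [folklore] -/
@[reducible]
def diagram : A.Idx ⥤ Scheme.{u} where
  obj a := a.U
  map f := A.transition f.le
  map_id a := by
    rw [← cancel_mono a.U.ι, transition_ι, Category.id_comp, comp_t_self, Scheme.homOfLE_ι]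
  map_comp {a b c} f g := by
    rw [← cancel_mono c.U.ι, transition_ι, Category.assoc, transition_ι]
    have hc := A.cocycle a.i b.i c.i a.U (W.homOfLE f.le.1) (A.transition f.le ≫ W.homOfLE g.le.1)
      (W.homOfLE (f ≫ g).le.1) (W.homOfLE_ι _)
      (by rw [Category.assoc, Scheme.homOfLE_ι, transition_ι]) (W.homOfLE_ι _)
    rw [← hc, Category.assoc]

/-- The diagram on objects. [folklore] -/
@[simp]
theorem diagram_obj (a : A.Idx) : A.diagram.obj a = a.U := rfl

/-- The diagram on morphisms. [folklore] -/
theorem diagram_map {a b : A.Idx} (f : a ⟶ b) : A.diagram.map f = A.transition f.le := rfl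

/-- The transitions of the diagram are open immersions. [folklore] -/
instance isOpenImmersion_diagram_map {a b : A.Idx} (f : a ⟶ b) :
    IsOpenImmersion (A.diagram.map f) := by
  rw [diagram_map]
  haveI := A.isOpenImmersion_t a.i b.i
  haveI : IsOpenImmersion (A.transition f.le ≫ b.U.ι) := by rw [transition_ι]; infer_instance
  exact @IsOpenImmersion.of_comp _ _ _ (A.transition f.le) b.U.ι (b.U.instIsOpenImmersionι) this

/-- **The diagram is locally directed**: if `x ∈ U ⊆ V i k` and `x' ∈ U' ⊆ V j k` have the same
image `t i k x = t j k x'` in chart `k`, then `x ∈ V i j` with `t i j x = x'`, and both come from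
the open `U ∩ t i j⁻¹(U')` of chart `i`. [folklore] -/
instance isLocallyDirected_diagram : (A.diagram ⋙ Scheme.forget).IsLocallyDirected where
  cond {a b c} fa fb xa xb hx := by
    have hx' : (A.transition fa.le xa).1 = (A.transition fb.le xb).1 := congrArg Subtype.val hx
    rw [transition_apply, transition_apply] at hx'
    -- `xa ∈ V i j` and `t i j xa = xb`
    have h1 : xa.1 ∈ A.V a.i c.i := fa.le.1 xa.2
    have h2 : xb.1 ∈ A.V b.i c.i := fb.le.1 xb.2
    have h3 : A.t a.i c.i ⟨xa.1, h1⟩ ∈ A.V c.i b.i := by rw [hx']; exact A.t_mem b.i c.i ⟨xb.1, h2⟩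
    have h4 : xa.1 ∈ A.V a.i b.i := A.dom a.i c.i b.i ⟨xa.1, h1⟩ h3
    have h5 : A.t a.i b.i ⟨xa.1, h4⟩ = xb.1 := by
      rw [← A.t_t_apply a.i c.i b.i xa.1 h1 h3]
      have := A.t_t_self_apply b.i c.i ⟨xb.1, h2⟩
      simp only [← hx'] at this ⊢
      exact this
    -- the open `U₀ := U ∩ (V i j).ι (t i j ⁻¹ U')` of chart `i`
    let U₀ : W.Opens := a.U ⊓ (A.V a.i b.i).ι ''ᵁ (A.t a.i b.i ⁻¹ᵁ b.U)
    let l : A.Idx := ⟨a.i, U₀⟩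
    have hla : l ≤ a := ⟨by change U₀ ≤ _; rw [A.V_self]; exact le_top,
      fun x hx hV ↦ by rw [A.t_self_apply]; exact hx.1⟩
    have hlb : l ≤ b := by
      refine ⟨fun x hx ↦ ?_, fun x hx hV ↦ ?_⟩
      · obtain ⟨-, ⟨y, -, rfl⟩⟩ := hx; exact y.2
      · obtain ⟨-, ⟨y, hy, hyx⟩⟩ := hx
        have : (⟨x, hV⟩ : ↥(A.V a.i b.i)) = y := Subtype.ext hyx.symm
        rw [this]; exact hy
    have hxU₀ : xa.1 ∈ U₀ := ⟨xa.2, ⟨xa.1, h4⟩, by change A.t a.i b.i ⟨xa.1, h4⟩ ∈ b.U; rw [h5]; exact xb.2, rfl⟩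
    refine ⟨l, homOfLE hla, homOfLE hlb, (⟨xa.1, hxU₀⟩ : U₀), ?_, ?_⟩
    · apply Subtype.ext
      change (A.transition hla ⟨xa.1, hxU₀⟩).1 = xa.1
      rw [transition_apply]
      exact A.t_self_apply a.i _
    · apply Subtype.ext
      change (A.transition hlb ⟨xa.1, hxU₀⟩).1 = xb.1
      rw [transition_apply]
      exact h5

/-! ### The glued scheme and its charts -/

/-- **The scheme glued from the atlas**: the colimit of the locally directed diagram of open
immersions `(i, U) ↦ U`. [cite: Milne1986JacobianVarieties, §7 (proof of Thm. 7.1)] -/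
abbrev glued : Scheme.{u} := colimit A.diagram

/-- **The chart** `W ↪ glued` with index `i`. [folklore] -/
def chart (i : A.ι) : W ⟶ A.glued :=
  W.topIso.inv ≫ (colimit.ι A.diagram ⟨i, ⊤⟩ : ((⊤ : W.Opens) : Scheme.{u}) ⟶ A.glued)

/-- The charts are open immersions. [folklore] -/
instance isOpenImmersion_chart (i : A.ι) : IsOpenImmersion (A.chart i) := by
  haveI : IsOpenImmersion (colimit.ι A.diagram ⟨i, ⊤⟩ : ((⊤ : W.Opens) : Scheme.{u}) ⟶ A.glued) :=
    inferInstanceAs (IsOpenImmersion (colimit.ι A.diagram ⟨i, ⊤⟩))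
  unfold chart; infer_instance

/-- Pointwise: `chart i x = colimit.ι (i, ⊤) x`. [folklore] -/
theorem chart_apply (i : A.ι) (x : W) :
    A.chart i x = colimit.ι A.diagram ⟨i, ⊤⟩ (⟨x, trivial⟩ : (⊤ : W.Opens)) := by
  have h1 : A.chart i x = colimit.ι A.diagram ⟨i, ⊤⟩ (W.topIso.inv x) := rfl
  have h2 : (W.topIso.inv x : (⊤ : W.Opens)) = ⟨x, trivial⟩ := by
    apply Subtype.ext
    change (W.topIso.inv ≫ (⊤ : W.Opens).ι) x = x
    rw [Scheme.toIso_inv_ι]; rfl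
  rw [h1, h2]

/-- `(i, U) ≤ (i, ⊤)`. [folklore] -/
theorem le_top' (a : A.Idx) : a ≤ ⟨a.i, ⊤⟩ :=
  ⟨A.le_V_self a.i a.U, fun _ _ _ ↦ trivial⟩

/-- The structure maps of the colimit in terms of the charts: `U ↪ W ↪ glued`. [folklore] -/
theorem colimit_ι_eq (a : A.Idx) : colimit.ι A.diagram a = a.U.ι ≫ A.chart a.i := by
  rw [← colimit.w A.diagram (homOfLE (A.le_top' a)), diagram_map, chart]
  have h : A.transition (A.le_top' a) ≫ W.topIso.hom = a.U.ι := by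
    change A.transition (A.le_top' a) ≫ (⊤ : W.Opens).ι = a.U.ι
    rw [transition_ι, comp_t_self, Scheme.homOfLE_ι]
  rw [← h, Category.assoc, Iso.hom_inv_id_assoc]

/-- **The gluing relation on charts**: on `V i j`, chart `i` is chart `j` after `t i j`. [folklore] -/
@[reassoc]
theorem ι_chart (i j : A.ι) : (A.V i j).ι ≫ A.chart i = A.t i j ≫ A.chart j := by
  have hle : (⟨i, A.V i j⟩ : A.Idx) ≤ ⟨j, ⊤⟩ := ⟨le_rfl, fun _ _ _ ↦ trivial⟩
  have h1 := A.colimit_ι_eq ⟨i, A.V i j⟩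
  rw [← colimit.w A.diagram (homOfLE hle), diagram_map, A.colimit_ι_eq ⟨j, ⊤⟩] at h1
  change A.transition hle ≫ (⊤ : W.Opens).ι ≫ A.chart j = (A.V i j).ι ≫ A.chart i at h1
  rw [← h1, transition_ι_assoc, Scheme.homOfLE_rfl, Category.id_comp]

/-- Pointwise gluing relation: `chart i x = chart j (t i j x)` for `x ∈ V i j`. [folklore] -/
theorem chart_apply_eq (i j : A.ι) (x : W) (hx : x ∈ A.V i j) :
    A.chart i x = A.chart j (A.t i j ⟨x, hx⟩) := by
  have := congrArg (fun φ ↦ φ ⟨x, hx⟩) (A.ι_chart i j)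
  simpa [Scheme.Hom.comp_apply] using this

/-- **When two chart points are glued**: `chart i x = chart j y` iff `x ∈ V i j` and
`t i j x = y`. [cite: Milne1986JacobianVarieties, §7 (proof of Thm. 7.1)] -/
theorem chart_eq_chart_iff (i j : A.ι) (x y : W) :
    A.chart i x = A.chart j y ↔ ∃ hx : x ∈ A.V i j, A.t i j ⟨x, hx⟩ = y := by
  refine ⟨fun h ↦ ?_, fun ⟨hx, hy⟩ ↦ by rw [A.chart_apply_eq i j x hx, hy]⟩
  have h' : colimit.ι A.diagram ⟨i, ⊤⟩ (⟨x, trivial⟩ : (⊤ : W.Opens)) =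
      colimit.ι A.diagram ⟨j, ⊤⟩ (⟨y, trivial⟩ : (⊤ : W.Opens)) := by
    rw [← chart_apply, ← chart_apply]; exact h
  obtain ⟨l, fi, fj, z, hzi, hzj⟩ := (Scheme.IsLocallyDirected.ι_eq_ι_iff A.diagram).mp h'
  have ezi : (A.transition fi.le z).1 = x := congrArg Subtype.val hzi
  have ezj : (A.transition fj.le z).1 = y := congrArg Subtype.val hzj
  rw [transition_apply] at ezi ezj
  -- `x = t l i z`, `y = t l j z`: so `x ∈ V i j` and `t i j x = t l j (t i l x) = y`
  have h1 : z.1 ∈ A.V l.i i := fi.le.1 z.2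
  have h2 : z.1 ∈ A.V l.i j := fj.le.1 z.2
  have h3 : x ∈ A.V i l.i := by rw [← ezi]; exact A.t_mem l.i i ⟨z.1, h1⟩
  have h4 : A.t i l.i ⟨x, h3⟩ = z.1 := by
    have := A.t_t_self_apply l.i i ⟨z.1, h1⟩
    simp only [ezi] at this
    convert this
  have h5 : A.t i l.i ⟨x, h3⟩ ∈ A.V l.i j := by rw [h4]; exact h2
  refine ⟨A.dom i l.i j ⟨x, h3⟩ h5, ?_⟩
  rw [← A.t_t_apply i l.i j x h3 h5, ← ezj]
  congr 1
  exact Subtype.ext h4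

/-- **The charts cover the glued scheme.** [folklore] -/
theorem exists_chart_apply_eq (z : A.glued) : ∃ (i : A.ι) (x : W), A.chart i x = z := by
  obtain ⟨a, x, rfl⟩ := Scheme.IsLocallyDirected.ι_jointly_surjective A.diagram z
  exact ⟨a.i, x.1, by rw [A.colimit_ι_eq a]; rfl⟩

/-- The open cover of the glued scheme by its charts. [folklore] -/
def openCover : A.glued.OpenCover :=
  Scheme.Cover.mkOfCovers A.ι (fun _ ↦ W) A.chart A.exists_chart_apply_eq

/-- **Morphisms out of the glued scheme**: a family `u i : W → Z` with `u i = u j ∘ t i j` on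
`V i j` glues to `glued → Z`. [folklore] -/
def desc {Z : Scheme.{u}} (u : A.ι → (W ⟶ Z)) (hu : ∀ i j, (A.V i j).ι ≫ u i = A.t i j ≫ u j) :
    A.glued ⟶ Z :=
  colimit.desc A.diagram
    { pt := Z
      ι := { app := fun a ↦ a.U.ι ≫ u a.i
             naturality := fun a b f ↦ by
               have e : A.transition f.le ≫ b.U.ι ≫ u b.i = a.U.ι ≫ u a.i := by
                 rw [transition_ι_assoc, ← hu, Scheme.homOfLE_ι_assoc]
               simp only [Functor.const_obj_map]
               exact e } }

/-- `chart i ≫ desc u = u i`. [folklore] -/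
@[reassoc (attr := simp)]
theorem chart_desc {Z : Scheme.{u}} (u : A.ι → (W ⟶ Z))
    (hu : ∀ i j, (A.V i j).ι ≫ u i = A.t i j ≫ u j) (i : A.ι) :
    A.chart i ≫ A.desc u hu = u i := by
  rw [chart, Category.assoc, desc, colimit.ι_desc]
  change W.topIso.inv ≫ (⊤ : W.Opens).ι ≫ u i = u i
  rw [Scheme.toIso_inv_ι_assoc]

/-- Two morphisms out of the glued scheme agreeing on every chart are equal. [folklore] -/
theorem hom_ext {Z : Scheme.{u}} {a b : A.glued ⟶ Z} (h : ∀ i, A.chart i ≫ a = A.chart i ≫ b) :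
    a = b :=
  Scheme.Cover.hom_ext A.openCover _ _ h

/-! ### The glued scheme over a base, and separatedness -/

section Base

variable {S : Scheme.{u}} (w : W ⟶ S) (hw : ∀ i j, A.t i j ≫ w = (A.V i j).ι ≫ w)

/-- **The structure map of the glued scheme** over a base `S` over which the transitions are
`S`-morphisms. [folklore] -/
def toBase : A.glued ⟶ S := A.desc (fun _ ↦ w) fun i j ↦ (hw i j).symm

/-- `chart i ≫ toBase = w`. [folklore] -/
@[reassoc (attr := simp)]
theorem chart_toBase (i : A.ι) : A.chart i ≫ A.toBase w hw = w := A.chart_desc _ _ i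

/-- **The graph of the transition** `t i j` in `W ×_S W`: `x ↦ (x, t i j x)` on `V i j`. [folklore] -/
def graph (i j : A.ι) : (A.V i j : Scheme.{u}) ⟶ pullback w w :=
  pullback.lift (A.V i j).ι (A.t i j) (hw i j).symm

/-- **Separatedness criterion for the glued scheme**: if the graphs of the transitions
`{(x, t i j x) : x ∈ V i j} ⊆ W ×_S W` are CLOSED (in `W ×_S W`, not merely in `V i j ×_S W`),
the glued scheme is separated over `S` (the diagonal is a closed immersion locally over the cover
of `glued ×_S glued` by the `W ×_S W`, where it is the graph). [folklore] -/
theorem isSeparated_toBase (h : ∀ i j, IsClosed (Set.range (A.graph w hw i j))) :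
    IsSeparated (A.toBase w hw) := by
  constructor
  let p := A.toBase w hw
  let 𝒰 := Scheme.Pullback.openCoverOfLeftRight A.openCover A.openCover p p
  refine (IsZariskiLocalAtTarget.iff_of_openCover (P := @IsClosedImmersion) 𝒰).mpr fun ij ↦ ?_
  obtain ⟨i, j⟩ := ij
  -- the piece `W ×_S W` (legs `chart ≫ p`) and its map `M` to `glued ×_S glued`
  change IsClosedImmersion (pullback.snd (pullback.diagonal p)
    (pullback.map (A.chart i ≫ p) (A.chart j ≫ p) p p (A.chart i) (A.chart j) (𝟙 S)
      (Category.comp_id _) (Category.comp_id _)))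
  obtain ⟨M, hM⟩ : ∃ M : pullback (A.chart i ≫ p) (A.chart j ≫ p) ⟶ pullback p p,
      M = pullback.map (A.chart i ≫ p) (A.chart j ≫ p) p p (A.chart i) (A.chart j) (𝟙 S)
        (Category.comp_id _) (Category.comp_id _) := ⟨_, rfl⟩
  have hM1 : M ≫ pullback.fst p p = pullback.fst _ _ ≫ A.chart i := by
    rw [hM]; exact pullback.lift_fst _ _ _
  have hM2 : M ≫ pullback.snd p p = pullback.snd _ _ ≫ A.chart j := by
    rw [hM]; exact pullback.lift_snd _ _ _
  rw [← hM]
  refine IsClosedImmersion.of_isPreimmersion _ ?_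
  -- the expected graph map into this piece
  have ec : ∀ i, A.chart i ≫ p = w := A.chart_toBase w hw
  obtain ⟨g, hg_def⟩ : ∃ g : (A.V i j : Scheme.{u}) ⟶ pullback (A.chart i ≫ p) (A.chart j ≫ p),
      g = pullback.lift (A.V i j).ι (A.t i j) (by rw [ec, ec]; exact (hw i j).symm) := ⟨_, rfl⟩
  have hg1 : g ≫ pullback.fst _ _ = (A.V i j).ι := by rw [hg_def, pullback.lift_fst]
  have hg2 : g ≫ pullback.snd _ _ = A.t i j := by rw [hg_def, pullback.lift_snd]
  have hg : IsClosed (Set.range g) := by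
    have e : g = A.graph w hw i j ≫ (pullback.congrHom (ec i) (ec j)).inv := by
      apply pullback.hom_ext
      · rw [hg1, Category.assoc, pullback.congrHom_inv, pullback.lift_fst, Category.comp_id, graph,
          pullback.lift_fst]
      · rw [hg2, Category.assoc, pullback.congrHom_inv, pullback.lift_snd, Category.comp_id, graph,
          pullback.lift_snd]
    have er : Set.range g = Scheme.homeoOfIso (pullback.congrHom (ec i) (ec j)).symm ''
        Set.range (A.graph w hw i j) := by
      rw [← Set.range_comp]
      congr 1
      funext x
      rw [e]
      rfl
    rw [er]
    exact (Scheme.homeoOfIso (pullback.congrHom (ec i) (ec j)).symm).isClosed_image.mpr (h i j)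
  -- `range (pullback.snd Δ M) = range g`
  let m := pullback.snd (pullback.diagonal p) M
  let n := pullback.fst (pullback.diagonal p) M
  have hm1 : m ≫ pullback.fst (A.chart i ≫ p) (A.chart j ≫ p) ≫ A.chart i = n := by
    have h2 := congrArg (· ≫ pullback.fst p p) (pullback.condition (f := pullback.diagonal p) (g := M))
    simp only [Category.assoc, pullback.diagonal_fst, Category.comp_id] at h2
    rw [hM1] at h2
    exact h2.symm
  have hm2 : m ≫ pullback.snd (A.chart i ≫ p) (A.chart j ≫ p) ≫ A.chart j = n := by
    have h2 := congrArg (· ≫ pullback.snd p p) (pullback.condition (f := pullback.diagonal p) (g := M))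
    simp only [Category.assoc, pullback.diagonal_snd, Category.comp_id] at h2
    rw [hM2] at h2
    exact h2.symm
  have hrange : Set.range m = Set.range g := by
    apply le_antisymm
    · -- `m = b ≫ g` with `b : Q → V i j` the lift of `m ≫ fst`
      have hb : Set.range (m ≫ pullback.fst (A.chart i ≫ p) (A.chart j ≫ p)) ⊆
          Set.range (A.V i j).ι := by
        rintro _ ⟨q, rfl⟩
        have e1 := congrArg (fun φ ↦ φ q) hm1
        have e2 := congrArg (fun φ ↦ φ q) hm2
        simp only [Scheme.Hom.comp_apply] at e1 e2
        obtain ⟨hx, -⟩ := (A.chart_eq_chart_iff i j _ _).mp (e1.trans e2.symm)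
        exact ⟨⟨_, hx⟩, rfl⟩
      let b := IsOpenImmersion.lift (A.V i j).ι (m ≫ pullback.fst _ _) hb
      have hbι : b ≫ (A.V i j).ι = m ≫ pullback.fst _ _ := IsOpenImmersion.lift_fac _ _ _
      have e : m = b ≫ g := by
        apply pullback.hom_ext
        · rw [Category.assoc, hg1, hbι]
        · rw [Category.assoc, hg2, ← cancel_mono (A.chart j), Category.assoc, Category.assoc,
            ← A.ι_chart, ← Category.assoc b, hbι, Category.assoc, hm1, hm2]
      rintro _ ⟨q, rfl⟩
      exact ⟨b q, by rw [e]; rfl⟩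
    · -- `g = a ≫ m` with `a : V i j → Q`
      let a : (A.V i j : Scheme.{u}) ⟶ pullback (pullback.diagonal p) M :=
        pullback.lift ((A.V i j).ι ≫ A.chart i) g (by
          apply pullback.hom_ext
          · rw [Category.assoc, pullback.diagonal_fst, Category.comp_id, Category.assoc, hM1,
              ← Category.assoc, hg1]
          · rw [Category.assoc, pullback.diagonal_snd, Category.comp_id, Category.assoc, hM2,
              ← Category.assoc, hg2]
            exact A.ι_chart i j)
      have e : g = a ≫ m := (pullback.lift_snd _ _ _).symm
      rintro _ ⟨x, rfl⟩
      exact ⟨a x, by rw [e]; rfl⟩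
  change IsClosed (Set.range m)
  rw [hrange]
  exact hg

/-- The glued scheme is reduced if the chart is. [folklore] -/
theorem isReduced_glued [IsReduced W] : IsReduced A.glued := by
  haveI : ∀ z : A.glued, _root_.IsReduced (A.glued.presheaf.stalk z) := fun z ↦ by
    obtain ⟨i, x, rfl⟩ := A.exists_chart_apply_eq z
    exact isReduced_of_injective _ (asIso ((A.chart i).stalkMap x)).commRingCatIsoToRingEquiv.injective
  exact isReduced_of_isReduced_stalk A.glued

/-- The glued scheme is locally of finite type over the base if the chart is. [folklore] -/
theorem locallyOfFiniteType_toBase [LocallyOfFiniteType w] :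
    LocallyOfFiniteType (A.toBase w hw) := by
  refine (IsZariskiLocalAtSource.iff_of_openCover (P := @LocallyOfFiniteType) A.openCover).mpr
    fun i ↦ ?_
  change LocallyOfFiniteType (A.chart i ≫ A.toBase w hw)
  rw [A.chart_toBase]
  infer_instance

end Base

end TransitionAtlas

end Literature.AlgebraicGeometry.RelativeSpec

end
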